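import Literature.MathematicalPhysics.QuantumFieldTheory.Balaban1983to89.B9Eq3153FrakGkBoundSlotDiagonal
import Literature.MathematicalPhysics.QuantumFieldTheory.Balaban1983to89.B9Eq3126H1LipschitzEnergy

/-!
# `Balaban1983to89.B9Eq3126KFloorSlotDiagonal` — T. Bałaban, *Propagators for lattice gauge theories in a background field*, Commun. Math. Phys. **99**
# (1985) 389–434 [Balaban1985BackgroundPropagators] (3.126) p. 420 *«HB = G̃Q*(QG̃Q*)⁻¹B»*, (3.130) p. 421, (3.122) p. 420, Thm 3.11 p. 416, with [Balaban1985Variational]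
# (45)–(46) p. 285: **THE `(QG̃Q*)⁻¹`-LETTER ACROSS A HESSIAN-SLOT CHANGE, VARIATIONALLY** — if two operators `Δ_a⁰`, `Δ_a¹` (same averaging `Q`) differ in FORM by
# `Θ·N(u)N(v)` and `Δ_a⁰` is `γ₀`-coercive in the weight `N`, then `re⟨y, K₁⁻¹y⟩ ≤ (1 + Θ∕γ₀)·re⟨y, K₀⁻¹y⟩` (`K_i = QG_iQ*`), hence `‖K₁⁻¹‖ ≤ (1 + Θ∕γ₀)·C_K`
# from a bound `C_K` of `K₀⁻¹`, and the energy rows of `H¹ = G₁Q*K₁⁻¹`; ON PRINT's DIAGONAL `ηL^{n+1} = 1` this transfers the chain's `K⁻¹`-letter at `U` to ANY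
# Hessian-slot perturbation `Δ̃_{a,k}(U) = Δ₁ + D_UR_kD*_U + Q_k*aQ_k` with `N₁`-form defect `θ ≤ γ₁∕2` — for `Δ₁ := π_k†Δ^ηπ_k` the `(QG̃Q*)⁻¹` of print's (3.126) and the
# rows of print's `H̃_{1,k}(U)` (plan v7 «the Δ_π port», the K̃-floor transfer; row OWNER t4-ne9-p1 gen 88)

statement-level skeleton of published theorems with citation tags; proofs where landed; nothing here is a claim about the Yang–Mills mass gap

CITATION HEADER (lean-in-tree rule).  Audit cell `pub-balaban`, sub-cell `t4`, BINDER row NE9; filed by the row OWNER lineage `b2b-balaban-t4-ne9-p1`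
(gen 88, plan v8 «the K̃-floor transfer + the π-junction»; `g87/DELTA-PI-PROGRAMME.md` §5 «K̃-floor transfer (only for an `H̃_k` bound BY ITSELF)»).  Sources
READ first-hand by this lineage in the held text layer [Balaban1985BackgroundPropagators] (`paper:balaban1985-cmp99-background-propagators`, journal page =
PDF page + 388) pp. 416 (Thm 3.11), 419–421 ((3.117)–(3.130)), 425–426 ((3.147)–(3.153), Thm 3.13); [Balaban1985Variational] p. 285 ((45)–(46)), p. 293.

THE PRINT (verbatim, text layer).  p. 420: *«To calculate the last integral we have to find a minimum of the functional … on configurations A satisfying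
QA = B, and G̃⁻¹ defined as G̃⁻¹ = Δ_π + DRD* + Q*aQ. … H B = G̃Q*(QG̃Q*)⁻¹B. (3.126) … the operator G̃ … differs from the operator investigated in previous
sections by the additional term Δ′_π, but we will prove that this term is a small perturbation of Δ_a, and that the operator G̃ used in the above formula has
all the properties formulated in Theorems 3.3, 3.10»*; p. 416: *«Theorem 3.11. Under the assumptions of the Theorems 3.1–3.10 (i.e. for M sufficiently large and α₀ sufficiently small) the operators Δ′_a, G′, (Q′G′²Q′*)⁻¹, Δ_a, G are positive definite.»*;
[B11] p. 285, (45)–(46): *«H₁B is the minimum of the quadratic form … on the set QA = B»*.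

WHY THIS FILE (cell context; DIAGNOSIS D-ne9p1-g87-1 and `DELTA-PI-PROGRAMME.md`).  The chain's `k`-th-step operator `B9Eq326OperatorTower.laplaceAk` carries the
BARE Hessian in its slot (print's `G₀`); print's `H` of (3.126) lives on `G̃⁻¹ = Δ_π + DRD* + Q*aQ` (3.122), typed at the `k`-th step by
`B9Eq3119DeltaPiTower.laplaceAkPi`.  The owner's `B9Eq3130HessianSlotPerturbationDiagonal` ∕ `B9Eq3153FrakGkBoundSlotDiagonal` moved coercivity, positivity and
the bounds of `G̃_k`, `H̃_kQ_kG̃_k`, `𝔊̃_k` across the slot; ne9-leaf-03's `B9Eq3126H1kLipschitzSlotDiagonal` ∕ `B9Eq3153FrakGkLipschitzSlotDiagonal` moved the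
Lipschitz rows with the chain's `K⁻¹`-letter `C_K` DISPLAYED.  A bound of print's `H̃_{1,k}(U) = G̃Q*(QG̃Q*)⁻¹` BY ITSELF needs the ONE letter not yet moved:
`(Q_kG̃_kQ_k*)⁻¹`.  THIS file moves it, with no test family re-built and no Neumann series: the minimiser's variational characterisation ([B11] (45)) makes
`re⟨y, K⁻¹y⟩` the MINIMAL energy on `{Qx = y}`, monotone in the form of `Δ_a`; the chain's own minimiser `H⁰y` is the test configuration.

WHAT IS PROVED (sorry-free; 0 `def`; [folklore] one variational inequality BY NAME + plumbing; nothing of [B9] asserted as printed).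
* §1 ABSTRACT (any `RCLike 𝕜`, finite-dimensional Hilbert `E`, `F`; `Δ_aⁱ = laplaceAK Δᵢ Dᵢ Rᵢ D*ᵢ Q Q† a`, SAME `Q`; a weight `N`; `γ₀N(z)² ≤ re⟨z, Δ_a⁰z⟩`;
  `‖⟨u, Δ_a¹v⟩ − ⟨u, Δ_a⁰v⟩‖ ≤ Θ·N(u)N(v)`): **`re_inner_H1K_laplaceAK_le_of_form_defect`** `re⟨H⁰y, Δ_a¹H⁰y⟩ ≤ (1 + Θ∕γ₀)·re⟨y, K₀⁻¹y⟩`;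
  **`re_inner_KinvK_le_of_form_defect`** (`Δ_a¹` symmetric) `re⟨y, K₁⁻¹y⟩ ≤ (1 + Θ∕γ₀)·re⟨y, K₀⁻¹y⟩`; **`norm_KinvK_le_of_form_defect`**
  `(‖K₀⁻¹y‖ ≤ C_K‖y‖) → ‖K₁⁻¹y‖ ≤ (1 + Θ∕γ₀)·C_K·‖y‖`; **`weight_H1K_le_of_form_defect`** `N(H¹b) ≤ √((1 + Θ∕γ₀)C_K∕γ₁)·‖b‖` at a `γ₁`-coercivity of `Δ_a¹`.
* §2 THE `k`-LEVEL DIAGONAL SLOT INSTANCE (binders of `B9Eq3153FrakGkBoundSlotDiagonal` §1 VERBATIM: E162's per-level data, `U(b) ∈ U1`, `hRS`, the windows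
  `‖U(b) − 1‖ ≤ αη`, `‖U(∂p) − 1‖ ≤ αη²`, `ε_j ≤ αr^j`, `|η|^d∕c₀ ≤ ρ_w`; the slot `Δ₁`, `0 ≤ θ ≤ γ₁∕2`, the `N₁`-form defect; `Δ̃` symmetric; ANY witnesses
  `hpos₁ hposU hQ`; the chain's letter `C_K ≥ 0` with `‖(Q_kG_kQ_k*)⁻¹c‖ ≤ C_K‖c‖` DISPLAYED): **`exists_KFloor_slot_diagonal`** — `∃ α₀ γ₁ C > 0` BEFORE every
  binder; then `‖KinvLatticeK hpos₁ hQ c‖ ≤ (1 + θ∕γ₁)·C_K·‖c‖` for all `c` AND, for all `b`, `‖H̃b‖, ‖curl₁(H̃b)‖, ‖div₁(H̃b)‖ ≤ C·√C_K·‖b‖`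
  (`H̃ = H1LatticeK hpos₁ hQ`, `C = √(3∕γ₁)`; `γ₁` the minimum of the slot file's and the bare file's coercivity constants).
INSTANCE (print's operator).  For `Δ₁ := (π_k(U))† ∘ Δ^η(U) ∘ π_k(U)`, `Δ̃` is `B9Eq3119DeltaPiTower.laplaceAkPi` by `rfl`, `θ := θ̄·α` is ne9-leaf-02's
`B9Eq3120DeltaPiPrimeFormDiagonalClosed.exists_form_defect_pi_diagonal_closed`, `hsymm₁` is `laplaceAkPi_isSymmetric`, and `C_K` is ne9-leaf-02's
`B9Eq3126H1BoundTowerVariational.exists_norm_KinvLatticeK_H1LatticeK_le_diagonal_closed`: print's `(QG̃Q*)⁻¹` of (3.126) is bounded by `(3∕2)C_K` and the rows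
of print's `H̃_{1,k}(U)` by `√(3C_K∕γ₁)` on the diagonal, level-free — consumed by the owner's junction for print's letters.

HONEST SCOPE.  Energy ∕ `L²` currency ONLY, on the diagonal, for an ABSTRACT slot with the θ-letter, the symmetry and `C_K` DISPLAYED as hypotheses (not
inhabited here); no kernel bound, no decay (Thm 3.10), NOT the (N)-reading; the small-field WINDOWS, `hRS`, `C_τ`, `ρ_w` stay HYPOTHESES; crude constants.
NOT summit progress (cell pub-balaban: NE9 NOT PRINTED ∕ NOT PROVED; «NE9 ⇐ the named binders»; row WALLED ON A MODEL (O-NE9-1; #5 UNRULED); spine PROVED 0∕9;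
rung (B)+1 finite T⁴ — NOT infinite volume, NOT mass gap, NOT BetaPertH, NOT Clay).  HONEST DEPENDENCY (cell line): continuum YM on T⁴ ⇐ BetaPertH ∧ nine spine
estimates (0/9 proved); BetaPertH ⇐ (D1) ∧ (D4) ∧ CAP+tail; G-an2-4 gates asym, D1 and NE2/3/4.  NEW file; nothing modified.  Net new unproved facts: 0.
-/

noncomputable section

open scoped InnerProductSpace ComplexConjugate BigOperators

namespace Literature.MathematicalPhysics.QuantumFieldTheory.Balaban1983to89.B9Eq3126KFloorSlotDiagonal

open B4Sect5Torus (TSite)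
open B9SectCLatticeCarrier (Bond)
open B11Eq103H1Complex (SiteL2K BondL2K covDerivL2K covDivL2K laplaceALatticeK laplaceAK laplaceAK_apply H1LatticeK KinvLatticeK H1K KinvK Q_H1K
  hKK_holds adjoint_injective_of_surjective)
open B9Eq310HessianOperator (adTransportW hessOp covCurlL2K)
open B9Eq310DeltaPrime (plaqHolU)
open B9Eq315QTorus (perCfg cornerSite)
open B9Eq315QTower (towerP UlevOf)
open B9Eq326OperatorTower (laplaceAk QkW RofUk)
open B7Prop1Explicit (U1 Wcx boxVec)
open B9Eq3153FrakGkBoundDiagonal (exists_energy_letters_diagonal_closed)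
open B9Eq3153FrakGkBoundSlotDiagonal (exists_energy_letters_slot_diagonal_closed)
open B9Eq3126GreenLettersVariational (inner_H1K_laplaceAK_H1K re_inner_KinvK_le_energy norm_KinvK_le_of_section)
open B9Eq3126H1LipschitzEnergy (weight_H1K_le)

/-! ## §1 Abstract: the `K⁻¹`-form is monotone in the form of `Δ_a` -/

section Abstract

variable {𝕜 : Type*} [RCLike 𝕜] {E : Type*} [NormedAddCommGroup E] [InnerProductSpace 𝕜 E] [FiniteDimensional 𝕜 E]
  {F : Type*} [NormedAddCommGroup F] [InnerProductSpace 𝕜 F] [FiniteDimensional 𝕜 F] {S : Type*} [NormedAddCommGroup S] [InnerProductSpace 𝕜 S]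
  {Δ₀ Δ₁ : E →ₗ[𝕜] E} {D₀ D₁ : S →ₗ[𝕜] E} {R₀ R₁ : S →ₗ[𝕜] S} {Dstar₀ Dstar₁ : E →ₗ[𝕜] S} {Q : E →ₗ[𝕜] F} {a : 𝕜}
  (hpos₀ : ∀ x : E, x ≠ 0 → 0 < RCLike.re ⟪x, laplaceAK Δ₀ D₀ R₀ Dstar₀ Q (LinearMap.adjoint Q) a x⟫_𝕜)
  (hpos₁ : ∀ x : E, x ≠ 0 → 0 < RCLike.re ⟪x, laplaceAK Δ₁ D₁ R₁ Dstar₁ Q (LinearMap.adjoint Q) a x⟫_𝕜)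
  (hadj : ∀ (x : E) (y : F), ⟪Q x, y⟫_𝕜 = ⟪x, LinearMap.adjoint Q y⟫_𝕜) (hinj : Function.Injective (LinearMap.adjoint Q))
  (N : E → ℝ) {γ₀ Θ : ℝ} (hγ₀ : 0 < γ₀) (hΘ : 0 ≤ Θ)
  (hcoer₀ : ∀ z : E, γ₀ * N z ^ 2 ≤ RCLike.re ⟪z, laplaceAK Δ₀ D₀ R₀ Dstar₀ Q (LinearMap.adjoint Q) a z⟫_𝕜)
  (hT : ∀ u v : E, ‖⟪u, laplaceAK Δ₁ D₁ R₁ Dstar₁ Q (LinearMap.adjoint Q) a v⟫_𝕜 - ⟪u, laplaceAK Δ₀ D₀ R₀ Dstar₀ Q (LinearMap.adjoint Q) a v⟫_𝕜‖ ≤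
    Θ * N u * N v)

include hγ₀ hΘ hcoer₀ hT in
/-- **THE CHAIN's MINIMISER AS A TEST CONFIGURATION FOR THE PERTURBED OPERATOR**: `re⟨H⁰y, Δ_a¹(H⁰y)⟩ ≤ (1 + Θ∕γ₀)·re⟨y, K₀⁻¹y⟩` — the form defect costs
`Θ·N(H⁰y)² ≤ (Θ∕γ₀)·re⟨H⁰y, Δ_a⁰H⁰y⟩` and `re⟨H⁰y, Δ_a⁰H⁰y⟩ = re⟨y, K₀⁻¹y⟩` (`B9Eq3126GreenLettersVariational.inner_H1K_laplaceAK_H1K`). [folklore]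
[cite: Balaban1985Variational, (45)–(46) p.285; Balaban1985BackgroundPropagators, (3.126) p.420, (3.130) p.421] -/
theorem re_inner_H1K_laplaceAK_le_of_form_defect (y : F) :
    RCLike.re ⟪H1K hpos₀ hadj hinj y, laplaceAK Δ₁ D₁ R₁ Dstar₁ Q (LinearMap.adjoint Q) a (H1K hpos₀ hadj hinj y)⟫_𝕜 ≤
      (1 + Θ / γ₀) * RCLike.re ⟪y, KinvK hpos₀ hadj hinj y⟫_𝕜 := by
  set x₀ := H1K hpos₀ hadj hinj y with hx₀
  have hE : RCLike.re ⟪x₀, laplaceAK Δ₀ D₀ R₀ Dstar₀ Q (LinearMap.adjoint Q) a x₀⟫_𝕜 = RCLike.re ⟪y, KinvK hpos₀ hadj hinj y⟫_𝕜 := by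
    rw [hx₀, inner_H1K_laplaceAK_H1K]
  have hd := hT x₀ x₀
  have h1 : RCLike.re ⟪x₀, laplaceAK Δ₁ D₁ R₁ Dstar₁ Q (LinearMap.adjoint Q) a x₀⟫_𝕜 ≤
      RCLike.re ⟪x₀, laplaceAK Δ₀ D₀ R₀ Dstar₀ Q (LinearMap.adjoint Q) a x₀⟫_𝕜 + Θ * N x₀ * N x₀ := by
    have h2 : RCLike.re (⟪x₀, laplaceAK Δ₁ D₁ R₁ Dstar₁ Q (LinearMap.adjoint Q) a x₀⟫_𝕜 -
        ⟪x₀, laplaceAK Δ₀ D₀ R₀ Dstar₀ Q (LinearMap.adjoint Q) a x₀⟫_𝕜) ≤ Θ * N x₀ * N x₀ := (RCLike.re_le_norm _).trans hd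
    rw [map_sub] at h2
    linarith
  have h3 : N x₀ ^ 2 ≤ γ₀⁻¹ * RCLike.re ⟪x₀, laplaceAK Δ₀ D₀ R₀ Dstar₀ Q (LinearMap.adjoint Q) a x₀⟫_𝕜 := by
    rw [inv_mul_eq_div, le_div_iff₀' hγ₀]; exact hcoer₀ x₀
  have h4 : Θ * N x₀ * N x₀ ≤ Θ * (γ₀⁻¹ * RCLike.re ⟪x₀, laplaceAK Δ₀ D₀ R₀ Dstar₀ Q (LinearMap.adjoint Q) a x₀⟫_𝕜) := by
    rw [mul_assoc, ← sq]; exact mul_le_mul_of_nonneg_left h3 hΘ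
  rw [hE] at h1 h4
  calc RCLike.re ⟪x₀, laplaceAK Δ₁ D₁ R₁ Dstar₁ Q (LinearMap.adjoint Q) a x₀⟫_𝕜
      ≤ RCLike.re ⟪y, KinvK hpos₀ hadj hinj y⟫_𝕜 + Θ * (γ₀⁻¹ * RCLike.re ⟪y, KinvK hpos₀ hadj hinj y⟫_𝕜) := by linarith
    _ = (1 + Θ / γ₀) * RCLike.re ⟪y, KinvK hpos₀ hadj hinj y⟫_𝕜 := by rw [div_eq_mul_inv]; ring

variable (hTs₁ : (laplaceAK Δ₁ D₁ R₁ Dstar₁ Q (LinearMap.adjoint Q) a).IsSymmetric)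

include hγ₀ hΘ hcoer₀ hT hTs₁ in
/-- **THE `K⁻¹`-FORM IS MONOTONE IN THE FORM OF `Δ_a`**: `re⟨y, K₁⁻¹y⟩ ≤ (1 + Θ∕γ₀)·re⟨y, K₀⁻¹y⟩` for `Δ_a¹` symmetric — [B11] (45): `re⟨y, K₁⁻¹y⟩` is the
MINIMAL `Δ_a¹`-energy on `{Qx = y}` (`B9Eq3126GreenLettersVariational.re_inner_KinvK_le_energy`), tested at the chain's minimiser `x = H⁰y`. [folklore]
[cite: Balaban1985Variational, (45)–(46) p.285; Balaban1985BackgroundPropagators, Thm 3.11 p.416, (3.126) p.420, (3.130) p.421] -/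
theorem re_inner_KinvK_le_of_form_defect (y : F) :
    RCLike.re ⟪y, KinvK hpos₁ hadj hinj y⟫_𝕜 ≤ (1 + Θ / γ₀) * RCLike.re ⟪y, KinvK hpos₀ hadj hinj y⟫_𝕜 :=
  (re_inner_KinvK_le_energy hpos₁ hadj hinj hTs₁ (Q_H1K hpos₀ hadj hinj y)).trans
    (re_inner_H1K_laplaceAK_le_of_form_defect hpos₀ hadj hinj N hγ₀ hΘ hcoer₀ hT y)

include hγ₀ hΘ hcoer₀ hT hTs₁ in
/-- **THE `K⁻¹`-LETTER TRANSFERS ACROSS THE SLOT**: a bound `‖K₀⁻¹y‖ ≤ C_K‖y‖` of the chain's letter gives `‖K₁⁻¹y‖ ≤ (1 + Θ∕γ₀)·C_K·‖y‖` — the chain's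
minimiser `H⁰` is a right inverse of `Q` of `Δ_a¹`-energy `(1 + Θ∕γ₀)C_K` (`B9Eq3126GreenLettersVariational.norm_KinvK_le_of_section`); the degenerate
`C_K = 0` forces `F = 0`. [folklore] [cite: Balaban1985BackgroundPropagators, Thm 3.11 p.416, (3.126) p.420, (3.130) p.421; Balaban1985Variational, (45) p.285] -/
theorem norm_KinvK_le_of_form_defect {CK : ℝ} (hCK : 0 ≤ CK) (hK₀ : ∀ y : F, ‖KinvK hpos₀ hadj hinj y‖ ≤ CK * ‖y‖) (y : F) :
    ‖KinvK hpos₁ hadj hinj y‖ ≤ (1 + Θ / γ₀) * CK * ‖y‖ := by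
  by_cases hc : CK = 0
  · -- `K₀⁻¹ = 0` forces `y = QG₀Q†K₀⁻¹y = 0`
    have hy : y = 0 := by
      have h0 : KinvK hpos₀ hadj hinj y = 0 := by
        have h := hK₀ y; rw [hc, zero_mul] at h; exact norm_le_zero_iff.1 h
      have h := hKK_holds hpos₀ hadj hinj y
      rw [h0, map_zero, map_zero, map_zero] at h
      exact h.symm
    rw [hy, map_zero, norm_zero, mul_zero]
  · have hCKp : 0 < CK := lt_of_le_of_ne hCK (Ne.symm hc)
    have hf : 0 < 1 + Θ / γ₀ := by positivity
    refine norm_KinvK_le_of_section hpos₁ hadj hinj hTs₁ (Sx := H1K hpos₀ hadj hinj) (Q_H1K hpos₀ hadj hinj) (mul_pos hf hCKp) ?_ y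
    intro z
    calc RCLike.re ⟪H1K hpos₀ hadj hinj z, laplaceAK Δ₁ D₁ R₁ Dstar₁ Q (LinearMap.adjoint Q) a (H1K hpos₀ hadj hinj z)⟫_𝕜
        ≤ (1 + Θ / γ₀) * RCLike.re ⟪z, KinvK hpos₀ hadj hinj z⟫_𝕜 := re_inner_H1K_laplaceAK_le_of_form_defect hpos₀ hadj hinj N hγ₀ hΘ hcoer₀ hT z
      _ ≤ (1 + Θ / γ₀) * (‖z‖ * ‖KinvK hpos₀ hadj hinj z‖) := mul_le_mul_of_nonneg_left (re_inner_le_norm _ _) hf.le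
      _ ≤ (1 + Θ / γ₀) * (‖z‖ * (CK * ‖z‖)) := by gcongr; exact hK₀ z
      _ = (1 + Θ / γ₀) * CK * ‖z‖ ^ 2 := by ring

include hγ₀ hΘ hcoer₀ hT hTs₁ in
/-- **THE ENERGY ROWS OF THE PERTURBED MINIMISER `H¹ = G₁Q†K₁⁻¹`**: `N(H¹b) ≤ √((1 + Θ∕γ₀)C_K∕γ₁)·‖b‖` at a `γ₁`-coercivity of `Δ_a¹` in the weight
(`B9Eq3126H1LipschitzEnergy.weight_H1K_le` at the transferred letter). [folklore]
[cite: Balaban1985Variational, (45)–(46) p.285; Balaban1985BackgroundPropagators, (3.126) p.420, Thm 3.11 p.416] -/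
theorem weight_H1K_le_of_form_defect (hN : ∀ w, 0 ≤ N w) {γ₁ : ℝ} (hγ₁ : 0 < γ₁)
    (hcoer₁ : ∀ z : E, γ₁ * N z ^ 2 ≤ RCLike.re ⟪z, laplaceAK Δ₁ D₁ R₁ Dstar₁ Q (LinearMap.adjoint Q) a z⟫_𝕜)
    {CK : ℝ} (hCK : 0 ≤ CK) (hK₀ : ∀ y : F, ‖KinvK hpos₀ hadj hinj y‖ ≤ CK * ‖y‖) (b : F) :
    N (H1K hpos₁ hadj hinj b) ≤ Real.sqrt ((1 + Θ / γ₀) * CK / γ₁) * ‖b‖ :=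
  weight_H1K_le hpos₁ hadj hinj N hN hγ₁ (by positivity) hcoer₁
    (norm_KinvK_le_of_form_defect hpos₀ hpos₁ hadj hinj N hγ₀ hΘ hcoer₀ hT hTs₁ hCK hK₀) b

end Abstract

/-! ## §2 The `k`-level diagonal slot instance -/

/-- From `x ≤ √S` data: `0 ≤ x`, `x² ≤ S` ⇒ `x ≤ √S`. [folklore] -/
private theorem le_sqrt_of_sq_le {x S : ℝ} (hx : 0 ≤ x) (h : x ^ 2 ≤ S) : x ≤ Real.sqrt S := by
  rw [← Real.sqrt_sq hx]; exact Real.sqrt_le_sqrt h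

/-- `√((1 + θ∕γ)·C∕(γ∕2)) ≤ √(3∕γ)·√C` for `θ ≤ γ∕2`, `0 < γ`, `0 ≤ C`. [folklore] -/
private theorem sqrt_transfer_le {θ γ C : ℝ} (hγ : 0 < γ) (hθ : θ ≤ γ / 2) (hC : 0 ≤ C) :
    Real.sqrt ((1 + θ / γ) * C / (γ / 2)) ≤ Real.sqrt (3 / γ) * Real.sqrt C := by
  rw [← Real.sqrt_mul (by positivity)]
  refine Real.sqrt_le_sqrt ?_
  have h1 : θ / γ ≤ 1 / 2 := by rw [div_le_iff₀ hγ]; linarith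
  have h2 : (1 + θ / γ) * C ≤ 3 / 2 * C := mul_le_mul_of_nonneg_right (by linarith) hC
  rw [div_le_iff₀ (by positivity : (0 : ℝ) < γ / 2)]
  calc (1 + θ / γ) * C ≤ 3 / 2 * C := h2
    _ = 3 / γ * C * (γ / 2) := by field_simp

variable {d : ℕ} (L : ℕ) [NeZero L] (hL : 1 ≤ L)
  {𝔸 : Type*} [NormedRing 𝔸] [NormedAlgebra ℂ 𝔸] [CompleteSpace 𝔸] [NormOneClass 𝔸] [StarRing 𝔸] [NormedStarGroup 𝔸] [StarModule ℂ 𝔸]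
  {W : Type*} [NormedAddCommGroup W] [InnerProductSpace ℂ W] [FiniteDimensional ℂ W] (φ : W ≃ₗ[ℂ] 𝔸)
  {Mφ Mφ' : ℝ} (hMφ : 0 ≤ Mφ) (hMφ' : 0 ≤ Mφ') (hφ : ∀ w, ‖φ w‖ ≤ Mφ * ‖w‖) (hφ' : ∀ X, ‖φ.symm X‖ ≤ Mφ' * ‖X‖)
  {a : ℝ} (ha : 0 < a) {r : ℝ} (hr0 : 0 ≤ r) (hr1 : r < 1)
  (τ : 𝔸 →ₗ[ℂ] ℂ) {Cτ : ℝ} (hτ : ∀ X, ‖τ X‖ ≤ Cτ * ‖X‖) (hCτ : 0 ≤ Cτ) {ρw : ℝ} (hρw : 0 ≤ ρw)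

include hMφ hMφ' hφ hφ' ha hr0 hr1 hτ hCτ hρw

/-- **THE `K̃⁻¹`-LETTER AND THE ROWS OF `H̃_{1,k}` FOR ANY HESSIAN-SLOT PERTURBATION ON THE DIAGONAL** — `∃ α₀ γ₁ C > 0` before every binder; then for
any slot `Δ₁` with `N₁`-form defect `θ ≤ γ₁∕2` against `Δ^η(U)`, `Δ̃ = Δ₁ + D_UR_kD*_U + Q_k*aQ_k` symmetric, ANY witnesses, and the chain's letter
`‖(Q_kG_kQ_k*)⁻¹c‖ ≤ C_K‖c‖` at `U`: `‖(Q_kG̃_kQ_k*)⁻¹c‖ ≤ (1 + θ∕γ₁)·C_K·‖c‖` and `‖H̃b‖, ‖curl₁(H̃b)‖, ‖div₁(H̃b)‖ ≤ C·√C_K·‖b‖` (`C = √(3∕γ₁)`) —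
print's `(QG̃Q*)⁻¹` and `H̃ = G̃Q*(QG̃Q*)⁻¹` of (3.126) for the instance `Δ₁ := π_k†Δ^ηπ_k`. [folklore]
[cite: Balaban1985BackgroundPropagators, (3.126) p.420, (3.130) p.421, (3.122) p.420, Thm 3.11 p.416; Balaban1985Variational, (45)–(46) p.285] -/
theorem exists_KFloor_slot_diagonal :
    ∃ α₀ γ₁ C : ℝ, 0 < α₀ ∧ 0 < γ₁ ∧ 0 < C ∧ ∀ (n : ℕ) (η : ℝ), η * (L : ℝ) ^ (n + 1) = 1 →
      ∀ (c₀ c₁ : ℝ) [Fact (0 < c₀)] [Fact (0 < c₁)], c₀ * ((L : ℝ) ^ (n + 1)) ^ d = c₁ → |η| ^ d / c₀ ≤ ρw →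
      ∀ (m : Fin d → ℕ) [∀ i, NeZero (m i)] (U : Bond d (towerP L m (n + 1)) → 𝔸ˣ) (αU : ℕ → ℝ) (hα1 : ∀ j, αU j ≤ 1 / 64)
        (hU1 : ∀ (j : ℕ) (x : B7Prop1Explicit.Site d) (κ : Fin d), perCfg (towerP L m (j + 1)) (UlevOf L m (n + 1) U j) x κ ∈ U1 𝔸)
        (hreg : ∀ (j : ℕ) (y : TSite d (towerP L m j)) (κ : Fin d) (r : Fin d → Fin L),
          ‖((Wcx L (perCfg (towerP L m (j + 1)) (UlevOf L m (n + 1) U j)) (cornerSite L y) κ (boxVec L r) : 𝔸ˣ) : 𝔸) - 1‖ ≤ αU j)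
        (εU : ℕ → ℝ), (∀ j, 0 ≤ εU j) → (∀ (j : ℕ) (b : Bond d (towerP L m (j + 1))), ‖(UlevOf L m (n + 1) U j b : 𝔸) - 1‖ ≤ εU j) →
      ∀ {α : ℝ}, 0 ≤ α → α ≤ α₀ →
        (∀ (b : Bond d (towerP L m (n + 1))) (v u : W), ⟪adTransportW φ U b v, u⟫_ℂ = ⟪v, adTransportW φ (fun b => (U b)⁻¹) b u⟫_ℂ) →
        (∀ b, U b ∈ U1 𝔸) → (∀ b, ‖(U b : 𝔸) - 1‖ ≤ α * η) →
        (∀ p : B9SectCLatticeCarrier.Plaq d (towerP L m (n + 1)), ‖(plaqHolU U p : 𝔸) - 1‖ ≤ α * η ^ 2) →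
        (∀ j < n + 1, εU j ≤ α * r ^ j) →
        ∀ (Δ₁ : BondL2K ℂ d (towerP L m (n + 1)) c₀ W →ₗ[ℂ] BondL2K ℂ d (towerP L m (n + 1)) c₀ W) {θ : ℝ}, 0 ≤ θ → θ ≤ γ₁ / 2 →
        (∀ u v : BondL2K ℂ d (towerP L m (n + 1)) c₀ W, ‖⟪u, Δ₁ v⟫_ℂ - ⟪u, hessOp φ η U τ v⟫_ℂ‖ ≤
            θ * Real.sqrt (‖covCurlL2K ℂ c₀ ((η : ℂ))⁻¹ (adTransportW φ (fun _ : Bond d (towerP L m (n + 1)) => (1 : 𝔸ˣ))) u‖ ^ 2 +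
                  ‖covDivL2K ℂ c₀ ((η : ℂ))⁻¹ (adTransportW φ fun _ : Bond d (towerP L m (n + 1)) => (1 : 𝔸ˣ)⁻¹) u‖ ^ 2 + ‖u‖ ^ 2) *
                Real.sqrt (‖covCurlL2K ℂ c₀ ((η : ℂ))⁻¹ (adTransportW φ (fun _ : Bond d (towerP L m (n + 1)) => (1 : 𝔸ˣ))) v‖ ^ 2 +
                  ‖covDivL2K ℂ c₀ ((η : ℂ))⁻¹ (adTransportW φ fun _ : Bond d (towerP L m (n + 1)) => (1 : 𝔸ˣ)⁻¹) v‖ ^ 2 + ‖v‖ ^ 2)) →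
        (laplaceALatticeK ((η : ℂ))⁻¹ (adTransportW φ U) (adTransportW φ fun b => (U b)⁻¹) Δ₁ (RofUk L m n φ η U)
            (QkW L m n φ U hL αU hα1 hU1 hreg (c₁ := c₁)) a).IsSymmetric →
        ∀ (hpos₁ : ∀ x : BondL2K ℂ d (towerP L m (n + 1)) c₀ W, x ≠ 0 →
            0 < RCLike.re ⟪x, laplaceALatticeK ((η : ℂ))⁻¹ (adTransportW φ U) (adTransportW φ fun b => (U b)⁻¹) Δ₁ (RofUk L m n φ η U)
              (QkW L m n φ U hL αU hα1 hU1 hreg (c₁ := c₁)) a x⟫_ℂ)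
          (hposU : ∀ x : BondL2K ℂ d (towerP L m (n + 1)) c₀ W, x ≠ 0 →
            0 < RCLike.re ⟪x, laplaceAk L m n φ η U hL αU hα1 hU1 hreg τ (c₀ := c₀) (c₁ := c₁) a x⟫_ℂ)
          (hQ : Function.Surjective (QkW L m n φ U hL αU hα1 hU1 hreg (c₀ := c₀) (c₁ := c₁))) {CK : ℝ}, 0 ≤ CK →
        (∀ c : BondL2K ℂ d m c₁ W, ‖KinvLatticeK hposU hQ c‖ ≤ CK * ‖c‖) →
        (∀ c : BondL2K ℂ d m c₁ W, ‖KinvLatticeK hpos₁ hQ c‖ ≤ (1 + θ / γ₁) * CK * ‖c‖) ∧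
        ∀ b : BondL2K ℂ d m c₁ W,
          ‖H1LatticeK hpos₁ hQ b‖ ≤ C * Real.sqrt CK * ‖b‖ ∧
          ‖covCurlL2K ℂ c₀ ((η : ℂ))⁻¹ (adTransportW φ (fun _ : Bond d (towerP L m (n + 1)) => (1 : 𝔸ˣ))) (H1LatticeK hpos₁ hQ b)‖ ≤
            C * Real.sqrt CK * ‖b‖ ∧
          ‖covDivL2K ℂ c₀ ((η : ℂ))⁻¹ (adTransportW φ fun _ : Bond d (towerP L m (n + 1)) => (1 : 𝔸ˣ)⁻¹) (H1LatticeK hpos₁ hQ b)‖ ≤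
            C * Real.sqrt CK * ‖b‖ := by
  -- the slot letters (`γs∕2`-coercivity under `θ ≤ γs∕2`) and the bare letters (`γb`-coercivity of the chain at `U`); `γ₁ := min γs γb`
  obtain ⟨α₁, γs, hα₁, hγs, HS⟩ := exists_energy_letters_slot_diagonal_closed (d := d) L hL φ hMφ hMφ' hφ hφ' ha hr0 hr1 τ hτ hCτ hρw
  obtain ⟨α₂, γb, hα₂, hγb, HB⟩ := exists_energy_letters_diagonal_closed (d := d) L hL φ hMφ hMφ' hφ hφ' ha hr0 hr1 τ hτ hCτ hρw
  have hγ₁ : 0 < min γs γb := lt_min hγs hγb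
  refine ⟨min α₁ α₂, min γs γb, Real.sqrt (3 / min γs γb), lt_min hα₁ hα₂, hγ₁, Real.sqrt_pos.2 (by positivity), ?_⟩
  intro n η hηL c₀ c₁ _ _ hw hρ m _ U αU hα1 hU1 hreg εU hεU hUε α hα0 hαle hRS hUb hUη hpl hεg Δ₁ θ hθ0 hθle hθ hsymm₁ hpos₁ hposU hQ CK hCK hK
  set γ₁ := min γs γb with hγ₁def
  have hγ₁s : γ₁ ≤ γs := min_le_left _ _
  have hγ₁b : γ₁ ≤ γb := min_le_right _ _
  have hαα₁ : α ≤ α₁ := hαle.trans (min_le_left _ _)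
  have hαα₂ : α ≤ α₂ := hαle.trans (min_le_right _ _)
  have hθs : θ ≤ γs / 2 := hθle.trans (by linarith)
  have HSx := HS n η hηL c₀ c₁ hw hρ m U αU hα1 hU1 hreg εU hεU hUε hα0 hαα₁ hRS hUb hUη hpl hεg Δ₁ hθ0 hθs hθ
  have HBx := HB n η hηL c₀ c₁ hw hρ m U αU hα1 hU1 hreg εU hεU hUε hα0 hαα₂ hRS hUb hUη hpl hεg
  -- the flat energy weight `N₁` (opaque)
  obtain ⟨N, hNdef⟩ : ∃ N : BondL2K ℂ d (towerP L m (n + 1)) c₀ W → ℝ, N = fun z =>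
      Real.sqrt (‖covCurlL2K ℂ c₀ ((η : ℂ))⁻¹ (adTransportW φ (fun _ : Bond d (towerP L m (n + 1)) => (1 : 𝔸ˣ))) z‖ ^ 2 +
        ‖covDivL2K ℂ c₀ ((η : ℂ))⁻¹ (adTransportW φ fun _ : Bond d (towerP L m (n + 1)) => (1 : 𝔸ˣ)⁻¹) z‖ ^ 2 + ‖z‖ ^ 2) := ⟨_, rfl⟩
  have hNz : ∀ z, N z = Real.sqrt (‖covCurlL2K ℂ c₀ ((η : ℂ))⁻¹ (adTransportW φ (fun _ : Bond d (towerP L m (n + 1)) => (1 : 𝔸ˣ))) z‖ ^ 2 +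
        ‖covDivL2K ℂ c₀ ((η : ℂ))⁻¹ (adTransportW φ fun _ : Bond d (towerP L m (n + 1)) => (1 : 𝔸ˣ)⁻¹) z‖ ^ 2 + ‖z‖ ^ 2) := fun z => by rw [hNdef]
  have hN0 : ∀ z, 0 ≤ N z := fun z => by rw [hNz]; exact Real.sqrt_nonneg _
  have hNsq : ∀ z, N z ^ 2 = ‖covCurlL2K ℂ c₀ ((η : ℂ))⁻¹ (adTransportW φ (fun _ : Bond d (towerP L m (n + 1)) => (1 : 𝔸ˣ))) z‖ ^ 2 +
        ‖covDivL2K ℂ c₀ ((η : ℂ))⁻¹ (adTransportW φ fun _ : Bond d (towerP L m (n + 1)) => (1 : 𝔸ˣ)⁻¹) z‖ ^ 2 + ‖z‖ ^ 2 := fun z => by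
    rw [hNz]; exact Real.sq_sqrt (add_nonneg (add_nonneg (sq_nonneg _) (sq_nonneg _)) (sq_nonneg _))
  have hNn : ∀ z, ‖z‖ ≤ N z := fun z => by
    rw [hNz]; exact le_sqrt_of_sq_le (norm_nonneg _) (le_add_of_nonneg_left (add_nonneg (sq_nonneg _) (sq_nonneg _)))
  have hNc : ∀ z, ‖covCurlL2K ℂ c₀ ((η : ℂ))⁻¹ (adTransportW φ (fun _ : Bond d (towerP L m (n + 1)) => (1 : 𝔸ˣ))) z‖ ≤ N z := fun z => by
    rw [hNz]; exact le_sqrt_of_sq_le (norm_nonneg _) ((le_add_of_nonneg_right (sq_nonneg _)).trans (le_add_of_nonneg_right (sq_nonneg _)))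
  have hNd : ∀ z, ‖covDivL2K ℂ c₀ ((η : ℂ))⁻¹ (adTransportW φ fun _ : Bond d (towerP L m (n + 1)) => (1 : 𝔸ˣ)⁻¹) z‖ ≤ N z := fun z => by
    rw [hNz]; exact le_sqrt_of_sq_le (norm_nonneg _) ((le_add_of_nonneg_left (sq_nonneg _)).trans (le_add_of_nonneg_right (sq_nonneg _)))
  -- the two coercivities in the weight, at `γ₁ = min γs γb`
  have hcoer1 : ∀ z, γ₁ / 2 * N z ^ 2 ≤ RCLike.re ⟪z, laplaceALatticeK ((η : ℂ))⁻¹ (adTransportW φ U) (adTransportW φ fun b => (U b)⁻¹) Δ₁ (RofUk L m n φ η U)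
      (QkW L m n φ U hL αU hα1 hU1 hreg (c₁ := c₁)) a z⟫_ℂ := fun z => by
    have h := (HSx z).1
    rw [← hNsq] at h
    exact (mul_le_mul_of_nonneg_right (by linarith) (sq_nonneg _)).trans h
  have hcoer0 : ∀ z, γ₁ * N z ^ 2 ≤ RCLike.re ⟪z, laplaceAk L m n φ η U hL αU hα1 hU1 hreg τ (c₀ := c₀) (c₁ := c₁) a z⟫_ℂ := fun z => by
    have h := (HBx z).1
    rw [← hNsq] at h
    exact (mul_le_mul_of_nonneg_right hγ₁b (sq_nonneg _)).trans h
  -- the form defect in the weight: the two operators differ by the slot only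
  have key : ∀ u v : BondL2K ℂ d (towerP L m (n + 1)) c₀ W,
      ⟪u, laplaceALatticeK ((η : ℂ))⁻¹ (adTransportW φ U) (adTransportW φ fun b => (U b)⁻¹) Δ₁ (RofUk L m n φ η U)
          (QkW L m n φ U hL αU hα1 hU1 hreg (c₁ := c₁)) a v⟫_ℂ -
        ⟪u, laplaceAk L m n φ η U hL αU hα1 hU1 hreg τ (c₀ := c₀) (c₁ := c₁) a v⟫_ℂ = ⟪u, Δ₁ v⟫_ℂ - ⟪u, hessOp φ η U τ v⟫_ℂ := by
    intro u v
    simp only [laplaceAk, laplaceALatticeK, laplaceAK_apply, inner_add_right]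
    ring
  have hT : ∀ u v : BondL2K ℂ d (towerP L m (n + 1)) c₀ W,
      ‖⟪u, laplaceALatticeK ((η : ℂ))⁻¹ (adTransportW φ U) (adTransportW φ fun b => (U b)⁻¹) Δ₁ (RofUk L m n φ η U)
          (QkW L m n φ U hL αU hα1 hU1 hreg (c₁ := c₁)) a v⟫_ℂ -
        ⟪u, laplaceAk L m n φ η U hL αU hα1 hU1 hreg τ (c₀ := c₀) (c₁ := c₁) a v⟫_ℂ‖ ≤ θ * N u * N v := fun u v => by
    rw [key, hNz u, hNz v, mul_assoc]; exact (hθ u v).trans_eq (by ring)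
  -- the structure letters
  have hadj : ∀ (x : BondL2K ℂ d (towerP L m (n + 1)) c₀ W) (z : BondL2K ℂ d m c₁ W),
      ⟪QkW L m n φ U hL αU hα1 hU1 hreg (c₀ := c₀) (c₁ := c₁) x, z⟫_ℂ = ⟪x, LinearMap.adjoint (QkW L m n φ U hL αU hα1 hU1 hreg (c₀ := c₀) (c₁ := c₁)) z⟫_ℂ :=
    fun x z => (LinearMap.adjoint_inner_right _ x z).symm
  have hinj := adjoint_injective_of_surjective _ hQ
  have hγ2 : 0 < γ₁ / 2 := by positivity
  refine ⟨fun c => ?_, fun b => ?_⟩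
  · -- the `K̃⁻¹`-letter: §1 with structure 0 := the chain at `U`, structure 1 := the slot
    exact norm_KinvK_le_of_form_defect (𝕜 := ℂ) hposU hpos₁ hadj hinj N hγ₁ hθ0 hcoer0 hT hsymm₁ hCK hK c
  · -- the energy rows of `H̃b`
    have hw : N (H1LatticeK hpos₁ hQ b) ≤ Real.sqrt (3 / γ₁) * Real.sqrt CK * ‖b‖ := by
      have h := weight_H1K_le_of_form_defect (𝕜 := ℂ) hposU hpos₁ hadj hinj N hγ₁ hθ0 hcoer0 hT hsymm₁ hN0 hγ2 hcoer1 hCK hK b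
      exact h.trans (mul_le_mul_of_nonneg_right (sqrt_transfer_le hγ₁ hθle hCK) (norm_nonneg _))
    exact ⟨(hNn _).trans hw, (hNc _).trans hw, (hNd _).trans hw⟩

end Literature.MathematicalPhysics.QuantumFieldTheory.Balaban1983to89.B9Eq3126KFloorSlotDiagonal

end
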